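import Mathlib
import Summits.ResolutionOfSingularities.ResolutionOfSingularities.Theorems.FrobeniusLadderFRationalResolutionCompletedBaseChangeFibrePoints
import Summits.ResolutionOfSingularities.ResolutionOfSingularities.Theorems.FrobeniusLadderFRationalResolutionCompletedBaseChangeFibreFinite
import Summits.ResolutionOfSingularities.ResolutionOfSingularities.Theorems.FrobeniusLadderFRationalResolutionCompletedBaseChangeFibreTransport
import Summits.ResolutionOfSingularities.ResolutionOfSingularities.Theorems.FrobeniusLadderFRationalResolutionSingularPointsFinite
import Summits.ResolutionOfSingularities.ResolutionOfSingularities.Theorems.FrobeniusLadderFRationalResolutionSingularPointsOverVertex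

/-!
# Crux `FrobeniusLadder.FRationalResolution` (stmt-ResolutionOfSingularities-15317), line `redirect`,
# stub `stub_diagonalizableQuotientResolution` — THE TRANSPORT STEP (T) ASSEMBLED FOR A CHARACTERISTIC CENTRE: **`hloc` at a
# twisted isolated point from chart-level facts on a MODEL `T` about `Bl_{J₀}(Spec T)`, `J₀` any `𝔳`-primary model of the
# characteristic centre `J₁ ⊆ Ê`** (the class-group recipe `J₁ = \overline{𝔞_tot^N}` of MEMO-15317-leafhand2-g16/g17/g18)

Companion of `…CompletedBaseChangeFibreAssembly` (naive centre `𝔪̂^{a+1}`). The consumer is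
`…SingularPointsFinite.hloc_of_characteristic_then_finite_singularPoints` (p840034): `J₁ ⊆ Ê = ((B ⊗_K K')_{𝔔'})^` characteristic
(`θ J₁ ⊆ J₁` for all ring automorphisms `θ`), `𝔪̂ⁿ ⊆ J₁ ≠ ⊤`, and `X₁ = Bl_{J₁}(Spec Ê)` with finitely many singular points, each with
`Bl_{𝔪_z}(Spec 𝒪_{X₁,z})` regular. Here the last two hypotheses (and `𝔪̂ⁿ ⊆ J₁ ≠ ⊤`) are discharged from a model:
* ★★★ **`hloc_of_model_charts_characteristic`** — Galois data as in p840034 and `J₁` characteristic; a MODEL `T` of finite type over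
  a field `κ` with a maximal ideal `𝔳`, `Spec T` regular at the primes `⊊ 𝔳`, a ring isomorphism `e : (T_𝔳)^ ≅ Ê`, an ideal
  `𝔳ⁿ ⊆ J₀ ⊆ 𝔳` of `T` generated by `x₁, …, x_m` with `e(J₀ (T_𝔳)^) = J₁`, and ON THE MODEL CHART RINGS `T[J₀/x_i]`: finitely many
  non-regular primes over `V(𝔳)`, at each of which `Bl_𝔪(Spec T[J₀/x_i]_𝔫)` is regular ⇒ **`hloc` at the twisted point `ι(𝔭)`**.
So for the class-group recipe what is left at a twisted isolated 3-fold point is: the chart computation on the model `κ'[P]`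
(the fan facts (β): Conjecture C3-tot, verified `r ≤ 42`, MEMO-g16/g17), the identification `e(J₀ (T_𝔳)^) = \overline{𝔞_tot(Ê)^N}` for a
monomial model `J₀` of the trace-ideal centre (MEMO-g18 (α′), `…TraceIdealsFiniteMonoidPowerSeries`), and the ring isomorphism
`(κ'[P]_𝔳)^ ≅ Ê` (g19/g20).

Honest label: assembly toward ONE leaf stub (no stub, crux or summit closed). No definitions, no named facts, no sorry.
[cite: StacksProject, Tag 080B; Tag 0804; Tag 0805] [cite: Matsumura1987, Thm. 8.11; Thm. 8.14; Thm. 23.7]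
[cite: GortzWedhorn2020, Prop. 13.91] [cite: Kollar2007, §2.2]
-/

noncomputable section

-- single-problem summit: the doubled namespace component is forced
set_option linter.dupNamespace false

open CategoryTheory AlgebraicGeometry IsLocalRing
open scoped TensorProduct
open Literature.AlgebraicGeometry.Resolution

namespace Summit.ResolutionOfSingularities.ResolutionOfSingularities.Theorems.FRationalResolution.CompletedBaseChangeFibreAssemblyChar

/-- ★★★ **`hloc` AT A TWISTED POINT FROM THE MODEL CHARTS, CHARACTERISTIC CENTRE.** See the module docstring.
[cite: StacksProject, Tag 080B; Tag 0804; Tag 0805] [cite: Matsumura1987, Thm. 8.11; Thm. 8.14; Thm. 23.7] [cite: Kollar2007, §2.2] -/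
theorem hloc_of_model_charts_characteristic (K : Type) [Field K] (X : Scheme.{0}) [IsIntegral X]
    (f : X ⟶ Spec (.of K)) [LocallyOfFiniteType f]
    {B : Type} [CommRing B] [IsDomain B] [Algebra K B] [Algebra.FiniteType K B]
    (ι : Spec (.of B) ⟶ X) [IsOpenImmersion ι] (hι : ι ≫ f = Spec.map (CommRingCat.ofHom (algebraMap K B)))
    (𝔭 : Ideal B) [h𝔭 : 𝔭.IsMaximal] (h𝔭0 : 𝔭 ≠ ⊥)
    (hsing : ι ⟨𝔭, h𝔭.isPrime⟩ ∉ Scheme.regularLocus X)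
    (hregB : ∀ P : Spec (.of B), P.asIdeal ≠ 𝔭 → P ∈ Scheme.regularLocus (Spec (.of B)))
    (K' : Type) [Field K'] [Algebra K K'] [FiniteDimensional K K'] [IsGalois K K']
    (𝔔' : Ideal (B ⊗[K] K')) [h𝔔' : 𝔔'.IsMaximal] (h𝔔'𝔭 : 𝔔'.comap (algebraMap B (B ⊗[K] K')) = 𝔭)
    (J₁ : Ideal (AdicCompletion (maximalIdeal (Localization.AtPrime 𝔔')) (Localization.AtPrime 𝔔')))
    (hchar : ∀ θ : AdicCompletion (maximalIdeal (Localization.AtPrime 𝔔')) (Localization.AtPrime 𝔔') ≃+*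
        AdicCompletion (maximalIdeal (Localization.AtPrime 𝔔')) (Localization.AtPrime 𝔔'), J₁.map (θ : _ →+* _) ≤ J₁)
    -- the model
    (κ : Type) [Field κ] (T : Type) [CommRing T] [Algebra κ T] [Algebra.FiniteType κ T] (𝔳 : Ideal T) [𝔳.IsMaximal]
    (hoff : ∀ t : Spec (.of T), t.asIdeal ≤ 𝔳 → t.asIdeal ≠ 𝔳 → t ∈ Scheme.regularLocus (Spec (.of T)))
    (e : AdicCompletion (maximalIdeal (Localization.AtPrime 𝔳)) (Localization.AtPrime 𝔳) ≃+*
      AdicCompletion (maximalIdeal (Localization.AtPrime 𝔔')) (Localization.AtPrime 𝔔'))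
    (J₀ : Ideal T) {n : ℕ} (hn : 𝔳 ^ n ≤ J₀) (hJ₀𝔳 : J₀ ≤ 𝔳) {m : ℕ} (x : Fin m → T) (hx : J₀ = Ideal.span (Set.range x))
    (hJ : (J₀.map (algebraMap T (AdicCompletion (maximalIdeal (Localization.AtPrime 𝔳)) (Localization.AtPrime 𝔳)))).map
      (e : _ →+* _) = J₁)
    (hfin : ∀ i : Fin m, {𝔫 : PrimeSpectrum (blowupAlgebra J₀ (x i)) |
      𝔳.map (algebraMap T (blowupAlgebra J₀ (x i))) ≤ 𝔫.asIdeal ∧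
        ¬ IsRegularLocalRing (Localization.AtPrime 𝔫.asIdeal)}.Finite)
    (hmodel : ∀ (i : Fin m) (𝔫 : PrimeSpectrum (blowupAlgebra J₀ (x i))),
      𝔳.map (algebraMap T (blowupAlgebra J₀ (x i))) ≤ 𝔫.asIdeal →
      ¬ IsRegularLocalRing (Localization.AtPrime 𝔫.asIdeal) →
      Scheme.IsRegular (affineBlowup (R := Localization.AtPrime 𝔫.asIdeal)
        (maximalIdeal (Localization.AtPrime 𝔫.asIdeal)))) :
    ∃ (V : X.Opens), ι ⟨𝔭, h𝔭.isPrime⟩ ∈ V ∧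
      (∀ t : X, t ∉ Scheme.regularLocus X → t ∈ V → t = ι ⟨𝔭, h𝔭.isPrime⟩) ∧
      ∃ (Y : Scheme.{0}) (ρ : Y ⟶ V), IsProper ρ ∧ Scheme.IsRegular Y ∧
        IsIso (ρ ∣_ (V.ι ⁻¹ᵁ ⟨Scheme.regularLocus X, isOpen_regularLocus_of_locallyOfFiniteType_field f⟩)) ∧
        Dense ((ρ ⁻¹ᵁ (V.ι ⁻¹ᵁ ⟨Scheme.regularLocus X,
          isOpen_regularLocus_of_locallyOfFiniteType_field f⟩) : Y.Opens) : Set Y) := by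
  -- instances on the Galois side (as in p840034)
  haveI : IsNoetherianRing B := Algebra.FiniteType.isNoetherianRing K B
  haveI : Algebra.FiniteType B (B ⊗[K] K') := inferInstance
  haveI : IsNoetherianRing (B ⊗[K] K') := Algebra.FiniteType.isNoetherianRing B (B ⊗[K] K')
  haveI : IsNoetherianRing (Localization.AtPrime 𝔔') :=
    IsLocalization.isNoetherianRing 𝔔'.primeCompl (Localization.AtPrime 𝔔') inferInstance
  have hfac : algebraMap (B ⊗[K] K') (AdicCompletion (maximalIdeal (Localization.AtPrime 𝔔')) (Localization.AtPrime 𝔔')) =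
      (algebraMap (Localization.AtPrime 𝔔') _).comp (algebraMap (B ⊗[K] K') (Localization.AtPrime 𝔔')) :=
    RingHom.ext fun _ => rfl
  have hmapQ : 𝔔'.map (algebraMap (B ⊗[K] K') (AdicCompletion (maximalIdeal (Localization.AtPrime 𝔔'))
      (Localization.AtPrime 𝔔'))) = maximalIdeal _ := by
    rw [hfac, ← Ideal.map_map, Localization.AtPrime.map_eq_maximalIdeal, ← AdicCompletion.maximalIdeal_eq_map]
  -- instances on the model side
  haveI : IsNoetherianRing T := Algebra.FiniteType.isNoetherianRing κ T
  haveI : IsNoetherianRing (Localization.AtPrime 𝔳) :=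
    IsLocalization.isNoetherianRing 𝔳.primeCompl (Localization.AtPrime 𝔳) inferInstance
  haveI : IsNoetherianRing (AdicCompletion (maximalIdeal (Localization.AtPrime 𝔳)) (Localization.AtPrime 𝔳)) :=
    isNoetherianRing_adicCompletion_maximalIdeal _
  -- singular points of the model blow-up lie over `V(𝔪̂)`
  have hReg : ∀ Q : Spec (.of (AdicCompletion (maximalIdeal (Localization.AtPrime 𝔳)) (Localization.AtPrime 𝔳))),
      ¬ 𝔳.map (algebraMap T _) ≤ Q.asIdeal → Q ∈ Scheme.regularLocus _ := fun Q hQ =>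
    SingularPointsOverVertex.mem_regularLocus_Spec_adicCompletion_of_not_le κ 𝔳 hoff Q hQ
  have hZ' := SingularPointsOverVertex.le_of_not_mem_regularLocus_of_pow_le
    (𝔳.map (algebraMap T (AdicCompletion (maximalIdeal (Localization.AtPrime 𝔳)) (Localization.AtPrime 𝔳))))
    (J₀.map (algebraMap T _)) (n := n) (by rw [← Ideal.map_pow]; exact Ideal.map_mono hn)
    (Ideal.map_mono hJ₀𝔳) hReg
  have hZ : ∀ z : affineBlowup (J₀.map (algebraMap T (AdicCompletion (maximalIdeal (Localization.AtPrime 𝔳))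
      (Localization.AtPrime 𝔳)))), z ∉ Scheme.regularLocus _ →
      𝔳 ≤ (affineBlowup.π _ z).asIdeal.comap (algebraMap T _) := fun z hz =>
    Ideal.map_le_iff_le_comap.mp (hZ' z hz)
  -- `hfin` and `hloc` on the model blow-up, from the charts
  have hfinm := CompletedBaseChangeFibreFinite.finite_compl_regularLocus_of_model_charts κ T 𝔳 x J₀ hx hfin hZ
  have hlocm : ∀ z ∈ (Scheme.regularLocus (affineBlowup (J₀.map (algebraMap T
      (AdicCompletion (maximalIdeal (Localization.AtPrime 𝔳)) (Localization.AtPrime 𝔳))))))ᶜ,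
      Scheme.IsRegular (affineBlowup (R := (affineBlowup (J₀.map (algebraMap T
        (AdicCompletion (maximalIdeal (Localization.AtPrime 𝔳)) (Localization.AtPrime 𝔳))))).presheaf.stalk z)
        (maximalIdeal _)) := fun z hz =>
    CompletedBaseChangeFibrePoints.hloc_stalk_of_model_charts κ T 𝔳 x J₀ hx hmodel z (hZ z hz)
      (by rwa [Set.mem_compl_iff, Scheme.mem_regularLocus] at hz)
  -- transport along `e`
  obtain ⟨hfin', hloc'⟩ := CompletedBaseChangeFibreTransport.hfin_hloc_of_ringEquiv e _ hfinm hlocm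
  rw [hJ] at hfin' hloc'
  -- `𝔪̂ⁿ ⊆ J₁ ⊆ 𝔪̂`
  have h𝔳e : (𝔳.map (algebraMap T (AdicCompletion (maximalIdeal (Localization.AtPrime 𝔳))
      (Localization.AtPrime 𝔳)))).map (e : _ →+* _) =
      𝔔'.map (algebraMap (B ⊗[K] K') (AdicCompletion (maximalIdeal (Localization.AtPrime 𝔔'))
        (Localization.AtPrime 𝔔'))) := by
    rw [CompletedBaseChangeFibreFlat.map_eq_maximalIdeal_adicCompletion T 𝔳, PointBlowupOfCompletion.map_maximalIdeal_ringEquiv e,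
      hmapQ]
  have hn' : 𝔔'.map (algebraMap (B ⊗[K] K') (AdicCompletion (maximalIdeal (Localization.AtPrime 𝔔'))
      (Localization.AtPrime 𝔔'))) ^ n ≤ J₁ := by
    rw [← h𝔳e, ← Ideal.map_pow, ← Ideal.map_pow, ← hJ]
    exact Ideal.map_mono (Ideal.map_mono hn)
  have hJ₁top : J₁ ≠ ⊤ := by
    rw [← hJ]
    intro htop
    have hle : (J₀.map (algebraMap T (AdicCompletion (maximalIdeal (Localization.AtPrime 𝔳))
        (Localization.AtPrime 𝔳)))).map (e : _ →+* AdicCompletion (maximalIdeal (Localization.AtPrime 𝔔')) (Localization.AtPrime 𝔔')) ≤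
        maximalIdeal (AdicCompletion (maximalIdeal (Localization.AtPrime 𝔔')) (Localization.AtPrime 𝔔')) := by
      rw [← hmapQ, ← h𝔳e]
      exact Ideal.map_mono (Ideal.map_mono hJ₀𝔳)
    rw [htop] at hle
    exact (maximalIdeal.isMaximal _).ne_top (top_le_iff.mp hle)
  exact SingularPointsFinite.hloc_of_characteristic_then_finite_singularPoints K X f ι hι 𝔭 h𝔭0 hsing hregB K' 𝔔' h𝔔'𝔭 J₁
    hn' hJ₁top hchar hfin' hloc'

end Summit.ResolutionOfSingularities.ResolutionOfSingularities.Theorems.FRationalResolution.CompletedBaseChangeFibreAssemblyChar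

end
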